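import Summits.QuantumFields.BalabanUV.T4Continuum.Support.VariationalVectorEndFlat
import Summits.QuantumFields.BalabanUV.T4Continuum.Support.VariationalVectorRegularityFlat

/-!
# T⁴ programme, spine node NE2 (U1a), lane P2 — leaf V-REG (1-forms), file 8: THE `U = 1` VECTOR END (leaf-10-g3, `VariationalVectorEndFlat.towerLimitRate_effV_flat`,
# p224030) WITH ITS `hREG` SOCKET DISCHARGED by file 6's `hREG_flat_closed` (`ρV k := rhoV (L^k) M 1`, `C_R k := C_R⋆ := 8Λ⋆ + 8·(BXp(d,1)²σ₀(d,1)⁻²)²·C_P⋆`,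
# `Λ⋆ = lamV d 0 d 0`, `C_P⋆ = (d+1)·Cst(d,1)`) — the η-rate of the flat vector effective operators `effV (L^k) M 1 (GmFlat) (QmL 1) a` with the ONLY displayed binder
# leaf V-ONE against the fine gauge form (`hONE`, parameters `ε₁ k ≤ c_ε θ^k`, `δ′ k ≤ c_δ′ θ^k`) (model level, `E = ℂ`; cell `pub-balaban`, NE2 formalisation swarm,
# leaf prover 03 gen 5)

HONEST FRAMING (T4-DAG p. 1).  Rung (B)+1 only — NOT infinite volume, NOT a mass gap, NOT Clay.  NE2 is NOT IN PRINT and NOT proved here.  FLAT data = the free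
field; bookkeeping ([folklore]) over p224030 (leaf-10-g3: V-UB ∕ V-P ∕ V-FED(curl) ∕ (SLICE) discharged at `U = 1`, V-ONE and V-REG displayed) and file 6 (V-REG at
`U = 1` for Bałaban's `projG 1 (ker Q′_1)`, V-UB fed by leaf-09-g7's `hUBc_tower`); V-ONE(slice′) stays DISPLAYED — by leaf-10-g3's `VariationalVectorBlockSpinGap` it is
NOT inhabitable with k-uniform `(ε₁, δ′) → 0` as an inequality against the gauge form of INDEPENDENT fine fields (located limitation N-ne2leaf01g6-1; leaf-01-g7's
min-value bracket is the proposed repair).  No `def`, no `sorry`; axioms standard.  HONEST DEPENDENCY (cell, verbatim): continuum YM on T⁴ ⇐ BetaPertH ∧ nine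
spine estimates (0/9 proved); BetaPertH ⇐ (D1) ∧ (D4) ∧ CAP+tail; G-an2-4 gates asym, D1 and NE2/3/4.
-/

noncomputable section

open scoped BigOperators ComplexConjugate ComplexOrder Matrix

namespace Summit.QuantumFields.BalabanUV.T4Continuum.VariationalVectorEndFlatReg

open Finset
open Literature.MathematicalPhysics.QuantumFieldTheory.Balaban1983to89.B5Prop11Plancherel (Tor fine Cst Cst_nonneg)
open Summit.QuantumFields.BalabanUV.T4Continuum.VariationalTransfer (blockSpin)
open Summit.QuantumFields.BalabanUV.T4Continuum.CovariantAveragingTower (TowerLimitRate)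
open Summit.QuantumFields.BalabanUV.T4Continuum.VectorBlockTrialForm (nsqV QvL)
open Summit.QuantumFields.BalabanUV.T4Continuum.VariationalVectorForm (ScV SfV qWV lamV lamV_nonneg)
open Summit.QuantumFields.BalabanUV.T4Continuum.VariationalVectorEffective (unc effV)
open Summit.QuantumFields.BalabanUV.T4Continuum.VariationalVectorTower (QmL)
open Summit.QuantumFields.BalabanUV.T4Continuum.VariationalVectorEndOfLeaves (eV ePV)
open Summit.QuantumFields.BalabanUV.T4Continuum.VariationalVectorOneStepPhys (rhoV rhoV_nonneg)
open Summit.QuantumFields.BalabanUV.T4Continuum.VariationalVectorGaugeSliceB5 (flatR)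
open Summit.QuantumFields.BalabanUV.T4Continuum.VariationalVectorGaugeSliceTower (Gk Gk' Gmk)
open Summit.QuantumFields.BalabanUV.T4Continuum.VariationalVectorGaugeSliceUB (hUBc_tower)
open Summit.QuantumFields.BalabanUV.T4Continuum.VariationalVectorEndFlat (towerLimitRate_effV_flat)
open Summit.QuantumFields.BalabanUV.T4Continuum.VariationalVectorRegularityFlat (hREG_flat_closed)
open Summit.QuantumFields.BalabanUV.T4Continuum.CTGaugeTerm (BXp)
open Summit.QuantumFields.BalabanUV.T4Continuum.ScalarAveragedCompression (sigma0)

variable {d : ℕ} (L : ℕ) [NeZero L] (M : Fin d → ℕ) [hM : ∀ μ, NeZero (M μ)]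

/-- **THE `U = 1` VECTOR END WITH V-REG DISCHARGED** (model level, `E = ℂ`, flat data): leaf-10-g3's `towerLimitRate_effV_flat` with `ρV k := rhoV (L^k) M 1` and the
k-UNIFORM regularity constant `C_R⋆ := 8·lamV d 0 d 0 + 8·(BXp(d,1)²·σ₀(d,1)⁻²)²·((d+1)·Cst(d,1))` supplied by `VariationalVectorRegularityFlat.hREG_flat_closed` (V-UB fed by
leaf-09-g7's `hUBc_tower`); displayed: `1 ≤ d`, the effective-action weight `a > 0`, the rate `θ ∈ [0,1)`, and leaf V-ONE against the fine gauge form (`hONE`, `ε₁`, `δ′`).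
[folklore] -/
theorem towerLimitRate_effV_flat_reg (hd : 1 ≤ d) {a : ℝ} (ha : 0 < a) (ε₁ δ' : ℕ → ℝ) {cε cδ' θ : ℝ}
    (hε₁ : ∀ k, 0 ≤ ε₁ k) (hδ' : ∀ k, 0 ≤ δ' k) (hθ : 0 ≤ θ) (hθ1 : θ < 1)
    (hεθ : ∀ k, ε₁ k ≤ cε * θ ^ k) (hδ'θ : ∀ k, δ' k ≤ cδ' * θ ^ k)
    (hONE : ∀ k W, blockSpin (QvL L (fine (L ^ k) M) (fun _ _ _ _ => (1 : ℂ →L[ℂ] ℂ))) (SfV (L ^ k) L M (flatR L (fine (L ^ k) M)) (Gk' L M k)) W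
      ≤ (Real.sqrt (ScV (L ^ k) M (flatR (L ^ k) M) (Gk L M k) W + ε₁ k * rhoV (L ^ k) M (flatR (L ^ k) M) W)
          + δ' k * Real.sqrt (qWV (L ^ k) M W)) ^ 2) :
    TowerLimitRate (ι := fun _ => Tor M × Fin d) (fun _ => (1 : Matrix (Tor M × Fin d) (Tor M × Fin d) ℂ)) 1
      (fun k => effV (L ^ k) M (flatR (L ^ k) M) (Gmk L M k) (QmL (L ^ k) M (fun _ _ _ _ => (1 : ℂ →L[ℂ] ℂ))) a)
      (eV (lamV d 0 d 0) (((d : ℝ) + 1) * Cst d 1) 0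
        + ePV (lamV d 0 d 0) (((d : ℝ) + 1) * Cst d 1)
            (8 * lamV d 0 d 0 + 8 * (BXp d 1 ^ 2 * ((sigma0 d 1) ^ 2)⁻¹) ^ 2 * ((d + 1 : ℝ) * Cst d 1)) cε cδ') θ := by
  have hΛ0 : 0 ≤ lamV d 0 d 0 := lamV_nonneg (Nat.cast_nonneg d) le_rfl
  have hCP0 : 0 ≤ (d + 1 : ℝ) * Cst d 1 := by have := Cst_nonneg d 1; positivity
  have hCR0 : 0 ≤ 8 * lamV d 0 d 0 + 8 * (BXp d 1 ^ 2 * ((sigma0 d 1) ^ 2)⁻¹) ^ 2 * ((d + 1 : ℝ) * Cst d 1) := by positivity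
  exact towerLimitRate_effV_flat L M hd ha (fun _ => 8 * lamV d 0 d 0 + 8 * (BXp d 1 ^ 2 * ((sigma0 d 1) ^ 2)⁻¹) ^ 2 * ((d + 1 : ℝ) * Cst d 1))
    ε₁ δ' (fun _ => hCR0) (fun _ => le_rfl) hε₁ hδ' hθ hθ1 hεθ hδ'θ (ρV := fun k => rhoV (L ^ k) M (flatR (L ^ k) M))
    (fun k W => rhoV_nonneg (L ^ k) M _ W) hONE (fun k => hREG_flat_closed (L ^ k) M hΛ0 (hUBc_tower L M hd k))

end Summit.QuantumFields.BalabanUV.T4Continuum.VariationalVectorEndFlatReg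

end
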